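import Summits.NavierStokesRegularity.FunctionalMining.TopEigAmplitudeFloorHolds
import Summits.NavierStokesRegularity.FunctionalMining.TopEigHeatCoerciveSymm
import HarnessLib

/-!
# FunctionalMining/NoGo — LEMMA AF mirrored by `v ↦ −v`: the `−λ₃` amplitude floor
# `q(q−1) ∫ (−λ₃)^{q−2} |∇λ₃|² ≤ heatDissipation Ψ_q v`, its equivalence with the `λ₁` node, and the
# SUM FLOOR for the 𝒦₁ candidate (c) `Φ_q + Ψ_q`

Search for candidate a priori estimates; no regularity claim. Cell `pub-nsfunc`, no-go seat
(gen 33), STAGED for the prove seat (the planner seat cannot file under `FunctionalMining/`;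
`pub-nsfunc-nogo/NoGo/STAGING.md`). CONDITIONAL STAGING: this file imports the node module
`TopEigAmplitudeFloor` — census-2's C2-LKB-5 `pub-nsfunc-census-2/lean/af/v3/TopEigAmplitudeFloor.lean`
(sha256 dac5012ad55a3252; the dict node `TopEigAmplitudeFloor q` = LEMMA AF as a `Prop` and its proof
`topEigAmplitudeFloor_of_two_le` for real `q ≥ 2`; statements identical in v1/v2/v3), whose filing is
requested and pending — and the TREE file `TopEigHeatCoerciveSymm.lean` (dict seat: `λ₁(−v) = −λ₃(v)`, `heatDissipation Φ (−v) =
heatDissipation (Φ ∘ Neg) v`, `Ψ_q = Φ_q ∘ Neg`). It compiles as soon as the node module is in the tree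
under that name; until then it was checked CUMULATIVELY (census-2's v3 file with this file appended,
farm rc 0, see `NoGo/STAGING.md`).

CONTENT (every finite index type `d`; the node's `card d = 3` clause is carried, not used).
LEMMA AF (`TopEigAmplitudeFloor q`: for smooth divergence-free `v` on `T³`,
`q(q−1)∫ λ₁^{q−2} Σᵢ (∂ᵢλ₁)² ≤ heatDissipation Φ_q v`, `λ₁ = torusStrainTopEig v`, `Φ_q = torusTopEigMoment q`)
sees AMPLITUDE MODULATION of the top strain eigenvalue. The 𝒦₁ candidate (c) of `NOGO.md` §3 D-K6 is the
symmetrised moment `Φ_q + Ψ_q`, `Ψ_q = torusNegBotEigMoment q = ∫((−λ₃)⁺)^q` (W18 kills `Φ_q` on `+w_k` and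
`Ψ_q` on `−w_k`, their sum from NEITHER sign; law OPEN, (W-1)). This file records, by the tree's
`v ↦ −v` dictionary and nothing else:
* `NegBotEigAmplitudeFloor q` — the mirrored node: `q(q−1)∫ (−λ₃)^{q−2} Σᵢ (∂ᵢ(−λ₃))² ≤
  heatDissipation Ψ_q v` for smooth divergence-free `v` (`card d = 3`);
* `negBotEigAmplitudeFloor_iff` — **`NegBotEigAmplitudeFloor q ↔ TopEigAmplitudeFloor q`** for every real
  `q` (apply either floor to `−v`: `λ₁(−v) = −λ₃(v)` pointwise, `∂ᵢ` commutes with negation of the field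
  only through the eigenvalue function, and `heatDissipation Φ_q (−v) = heatDissipation Ψ_q v`);
* `negBotEigAmplitudeFloor_of_two_le` — hence the `−λ₃` floor HOLDS for every real `q ≥ 2` (from census-2's
  `topEigAmplitudeFloor_of_two_le`);
* `TopEigAmplitudeFloor.sum_floor` — **the SUM FLOOR**: for `q ≥ 2`, smooth divergence-free `v` on `T³`,
  `q(q−1)[∫ λ₁^{q−2}|∇λ₁|² + ∫ (−λ₃)^{q−2}|∇λ₃|²] ≤ heatDissipation Φ_q v + heatDissipation Ψ_q v` — the
  amplitude part of the heat price of candidate (c) (its heat price is `≥` the right side only if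
  `heatDissipation` were additive; it is a supremum of difference quotients, SUBADDITIVE in `Φ` in the
  wrong direction for that, so the sum of the two dissipations — not `heatDissipation (Φ_q + Ψ_q)` — is
  what is bounded here; both are the quantities the W18 bookkeeping of D-K6 (c) uses, PROPOSITION Ψ);
* `TopEigAmplitudeFloor.exists_amplitude_le_of_heat_le` (+ the `−λ₃` mirror, and both unconditionally
  for `q ≥ 2`: `exists_topEig_amplitude_le_of_heat_le`, `exists_negBotEig_amplitude_le_of_heat_le`) —
  **KILLING FAMILIES FLATTEN `λ₁`**: the heat hypothesis of the kill door (`heatDissipation Φ_q (w i) ≤ ε`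
  attained for every `ε > 0`, as in `NoGo/TopEigSaturatingKill*` and `TopEigStrainMixRateLink`) forces
  `q(q−1)∫ λ₁^{q−2}|∇λ₁|² (w i) ≤ δ` attained for every `δ > 0` — the witness families of escape door
  D-K6 (a) are asymptotically amplitude-flat in the top strain eigenvalue (structural constraint on
  witnesses, instruction (i)/(ii) of the no-go seat).

NOT CLAIMED: any law for `Φ_q + Ψ_q` or for `Ψ_q` (OPEN); any statement for `q < 2`; any relation between
`heatDissipation (Φ_q + Ψ_q)` and the sum of the two dissipations beyond the remark above; nothing about
Navier–Stokes regularity or blow-up. [ours, bookkeeping; the `v ↦ −v` mirror of LEMMA AF; D-K6 (c)]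
FILING (prove seat g25, REQUEST #15): declarations byte-identical to the no-go seat's staged `NegBotEigAmplitudeFloor.STAGING.lean` 50798e869c0c371e; the node module was filed SPLIT (`TopEigAmplitudeFloor` §0–§4 + `TopEigAmplitudeFloorHolds` §5–§6 with `topEigAmplitudeFloor_of_two_le`), so the first import line names `…TopEigAmplitudeFloorHolds`; these are the only two changes.
-/

noncomputable section

open MeasureTheory Set Filter Topology

namespace Summit.NavierStokesRegularity.FunctionalMining

open Literature.Analysis.FunctionSpaces Literature.Analysis.FluidPDE

variable {d : Type*} [Fintype d] [DecidableEq d]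

/-- **The mirrored node.** `NegBotEigAmplitudeFloor q`: on `T³`, for every smooth divergence-free `v`,
`q(q−1) ∫ (−λ₃)^{q−2} Σᵢ (∂ᵢ(−λ₃))² ≤ heatDissipation Ψ_q v` (`λ₃ = torusStrainBotEig v`,
`Ψ_q = torusNegBotEigMoment q`; junk-valued `Torus.partialDeriv` as in the `λ₁` node). Search for
candidate a priori estimates; no regularity claim — a `Prop`, nothing is asserted by the definition.
[ours, bookkeeping] -/
def NegBotEigAmplitudeFloor (q : ℝ) : Prop :=
  Fintype.card d = 3 →
    ∀ v : UnitAddTorus d → EuclideanSpace ℝ d, Torus.IsSmooth v → Torus.IsDivFree v →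
      q * (q - 1) * ∫ x, (-torusStrainBotEig v x) ^ (q - 2) *
          ∑ i, (Torus.partialDeriv i (fun y => -torusStrainBotEig v y) x) ^ 2 ≤
        heatDissipation (torusNegBotEigMoment q) v

/-- `λ₁ ∘ S_{−v} = −λ₃ ∘ S_v` as functions. [tree `torusStrainTopEig_neg`, bookkeeping] -/
theorem torusStrainTopEig_neg_fun (v : UnitAddTorus d → EuclideanSpace ℝ d) :
    (fun y => torusStrainTopEig (-v) y) = fun y => -torusStrainBotEig v y :=
  funext fun y => torusStrainTopEig_neg v y

/-- `−λ₃ ∘ S_{−v} = λ₁ ∘ S_v` as functions. [tree `torusStrainBotEig_neg`, bookkeeping] -/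
theorem neg_torusStrainBotEig_neg_fun (v : UnitAddTorus d → EuclideanSpace ℝ d) :
    (fun y => -torusStrainBotEig (-v) y) = fun y => torusStrainTopEig v y :=
  funext fun y => by rw [torusStrainBotEig_neg, neg_neg]

/-- `heatDissipation Φ_q (−v) = heatDissipation Ψ_q v`. [tree `heatDissipation_neg`,
`torusNegBotEigMoment_eq_comp_neg`; bookkeeping] -/
theorem heatDissipation_topEigMoment_neg (q : ℝ) (v : UnitAddTorus d → EuclideanSpace ℝ d) :
    heatDissipation (torusTopEigMoment q) (-v) = heatDissipation (torusNegBotEigMoment q) v := by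
  rw [heatDissipation_neg, torusNegBotEigMoment_eq_comp_neg]

/-- `heatDissipation Ψ_q (−v) = heatDissipation Φ_q v`. [bookkeeping] -/
theorem heatDissipation_negBotEigMoment_neg (q : ℝ) (v : UnitAddTorus d → EuclideanSpace ℝ d) :
    heatDissipation (torusNegBotEigMoment q) (-v) = heatDissipation (torusTopEigMoment q) v := by
  rw [← heatDissipation_topEigMoment_neg, neg_neg]

/-- **`TopEigAmplitudeFloor q → NegBotEigAmplitudeFloor q`** (every real `q`): apply the `λ₁` floor to
`−v`. [ours, bookkeeping] -/
theorem TopEigAmplitudeFloor.negBot {q : ℝ} (h : TopEigAmplitudeFloor (d := d) q) :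
    NegBotEigAmplitudeFloor (d := d) q := by
  intro hd v hv hdv
  have h' := h hd (-v) hv.neg ((torus_isDivFree_neg_iff v).2 hdv)
  rw [torusStrainTopEig_neg_fun, heatDissipation_topEigMoment_neg] at h'
  simpa only [torusStrainTopEig_neg] using h'

/-- **`NegBotEigAmplitudeFloor q → TopEigAmplitudeFloor q`** (every real `q`): apply the `−λ₃` floor to
`−v`. [ours, bookkeeping] -/
theorem NegBotEigAmplitudeFloor.top {q : ℝ} (h : NegBotEigAmplitudeFloor (d := d) q) :
    TopEigAmplitudeFloor (d := d) q := by
  intro hd v hv hdv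
  have h' := h hd (-v) hv.neg ((torus_isDivFree_neg_iff v).2 hdv)
  rw [neg_torusStrainBotEig_neg_fun, heatDissipation_negBotEigMoment_neg] at h'
  simpa only [torusStrainBotEig_neg, neg_neg] using h'

/-- **The two amplitude floors are ONE statement: `NegBotEigAmplitudeFloor q ↔ TopEigAmplitudeFloor q`**
(every real `q`, every finite index type). [ours, bookkeeping] -/
theorem negBotEigAmplitudeFloor_iff (q : ℝ) :
    NegBotEigAmplitudeFloor (d := d) q ↔ TopEigAmplitudeFloor (d := d) q :=
  ⟨NegBotEigAmplitudeFloor.top, TopEigAmplitudeFloor.negBot⟩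

/-- **The `−λ₃` amplitude floor HOLDS for every real `q ≥ 2`.** [ours; census-2's
`topEigAmplitudeFloor_of_two_le` mirrored] -/
theorem negBotEigAmplitudeFloor_of_two_le {q : ℝ} (hq : 2 ≤ q) : NegBotEigAmplitudeFloor (d := d) q :=
  (topEigAmplitudeFloor_of_two_le hq).negBot

/-- **THE SUM FLOOR for candidate (c).** For real `q ≥ 2` and smooth divergence-free `v` on `T³`:
`q(q−1)[∫ λ₁^{q−2} Σᵢ(∂ᵢλ₁)² + ∫ (−λ₃)^{q−2} Σᵢ(∂ᵢ(−λ₃))²] ≤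
heatDissipation Φ_q v + heatDissipation Ψ_q v`. [ours, bookkeeping; D-K6 (c)] -/
theorem TopEigAmplitudeFloor.sum_floor {q : ℝ} (hq : 2 ≤ q) (hd : Fintype.card d = 3)
    {v : UnitAddTorus d → EuclideanSpace ℝ d} (hv : Torus.IsSmooth v) (hdv : Torus.IsDivFree v) :
    q * (q - 1) * ((∫ x, torusStrainTopEig v x ^ (q - 2) *
          ∑ i, (Torus.partialDeriv i (fun y => torusStrainTopEig v y) x) ^ 2) +
        ∫ x, (-torusStrainBotEig v x) ^ (q - 2) *
          ∑ i, (Torus.partialDeriv i (fun y => -torusStrainBotEig v y) x) ^ 2) ≤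
      heatDissipation (torusTopEigMoment q) v + heatDissipation (torusNegBotEigMoment q) v := by
  have h1 := topEigAmplitudeFloor_of_two_le (d := d) hq hd v hv hdv
  have h2 := negBotEigAmplitudeFloor_of_two_le (d := d) hq hd v hv hdv
  rw [mul_add]
  exact add_le_add h1 h2

/-! ## Killing families flatten `λ₁` (and `−λ₃`): the amplitude part of a vanishing heat price vanishes -/

/-- **A family with vanishing `Φ_q` heat price has vanishing `λ₁`-amplitude functional** (under the node,
every real `q`): if `heatDissipation Φ_q (w i) ≤ ε` is attained in the family for every `ε > 0` — the
heat hypothesis `hheat` of the kill door `not_topEigMoment_saturatingLawSup_of_family_of_scaling` and of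
`TopEigStrainMixRateLink` — then so is `q(q−1)∫ λ₁^{q−2} Σᵢ(∂ᵢλ₁)² ≤ δ` for every `δ > 0`. The witness
families of escape door D-K6 (a) are asymptotically AMPLITUDE-FLAT in the top strain eigenvalue (weighted
`H¹` sense); W18 achieves its vanishing heat price this way (pen-side: THEOREM R). [ours, bookkeeping] -/
theorem TopEigAmplitudeFloor.exists_amplitude_le_of_heat_le {q : ℝ} (h : TopEigAmplitudeFloor (d := d) q)
    (hd : Fintype.card d = 3) {ι : Type*} {w : ι → UnitAddTorus d → EuclideanSpace ℝ d}
    (hw : ∀ i, Torus.IsSmooth (w i)) (hdw : ∀ i, Torus.IsDivFree (w i))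
    (hheat : ∀ ε : ℝ, 0 < ε → ∃ i, heatDissipation (torusTopEigMoment q) (w i) ≤ ε)
    {δ : ℝ} (hδ : 0 < δ) :
    ∃ i, q * (q - 1) * ∫ x, torusStrainTopEig (w i) x ^ (q - 2) *
        ∑ k, (Torus.partialDeriv k (fun y => torusStrainTopEig (w i) y) x) ^ 2 ≤ δ := by
  obtain ⟨i, hi⟩ := hheat δ hδ
  exact ⟨i, (h hd (w i) (hw i) (hdw i)).trans hi⟩

/-- The same for the `−λ₃` row: vanishing `Ψ_q` heat price along a family forces vanishing
`q(q−1)∫ (−λ₃)^{q−2} Σᵢ(∂ᵢ(−λ₃))²` (under the mirrored node, every real `q`). [ours, bookkeeping] -/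
theorem NegBotEigAmplitudeFloor.exists_amplitude_le_of_heat_le {q : ℝ}
    (h : NegBotEigAmplitudeFloor (d := d) q) (hd : Fintype.card d = 3) {ι : Type*}
    {w : ι → UnitAddTorus d → EuclideanSpace ℝ d}
    (hw : ∀ i, Torus.IsSmooth (w i)) (hdw : ∀ i, Torus.IsDivFree (w i))
    (hheat : ∀ ε : ℝ, 0 < ε → ∃ i, heatDissipation (torusNegBotEigMoment q) (w i) ≤ ε)
    {δ : ℝ} (hδ : 0 < δ) :
    ∃ i, q * (q - 1) * ∫ x, (-torusStrainBotEig (w i) x) ^ (q - 2) *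
        ∑ k, (Torus.partialDeriv k (fun y => -torusStrainBotEig (w i) y) x) ^ 2 ≤ δ := by
  obtain ⟨i, hi⟩ := hheat δ hδ
  exact ⟨i, (h hd (w i) (hw i) (hdw i)).trans hi⟩

/-- **Unconditionally for real `q ≥ 2`**: a family of smooth divergence-free fields on `T³` along which
the `Φ_q` heat price is arbitrarily small has arbitrarily small `λ₁`-amplitude functional
`q(q−1)∫ λ₁^{q−2}|∇λ₁|²`. [ours; census-2's `topEigAmplitudeFloor_of_two_le` composed] -/
theorem exists_topEig_amplitude_le_of_heat_le {q : ℝ} (hq : 2 ≤ q) (hd : Fintype.card d = 3)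
    {ι : Type*} {w : ι → UnitAddTorus d → EuclideanSpace ℝ d}
    (hw : ∀ i, Torus.IsSmooth (w i)) (hdw : ∀ i, Torus.IsDivFree (w i))
    (hheat : ∀ ε : ℝ, 0 < ε → ∃ i, heatDissipation (torusTopEigMoment q) (w i) ≤ ε)
    {δ : ℝ} (hδ : 0 < δ) :
    ∃ i, q * (q - 1) * ∫ x, torusStrainTopEig (w i) x ^ (q - 2) *
        ∑ k, (Torus.partialDeriv k (fun y => torusStrainTopEig (w i) y) x) ^ 2 ≤ δ :=
  (topEigAmplitudeFloor_of_two_le hq).exists_amplitude_le_of_heat_le hd hw hdw hheat hδ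

/-- The `−λ₃` version, unconditionally for real `q ≥ 2`. [ours] -/
theorem exists_negBotEig_amplitude_le_of_heat_le {q : ℝ} (hq : 2 ≤ q) (hd : Fintype.card d = 3)
    {ι : Type*} {w : ι → UnitAddTorus d → EuclideanSpace ℝ d}
    (hw : ∀ i, Torus.IsSmooth (w i)) (hdw : ∀ i, Torus.IsDivFree (w i))
    (hheat : ∀ ε : ℝ, 0 < ε → ∃ i, heatDissipation (torusNegBotEigMoment q) (w i) ≤ ε)
    {δ : ℝ} (hδ : 0 < δ) :
    ∃ i, q * (q - 1) * ∫ x, (-torusStrainBotEig (w i) x) ^ (q - 2) *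
        ∑ k, (Torus.partialDeriv k (fun y => -torusStrainBotEig (w i) y) x) ^ 2 ≤ δ :=
  (negBotEigAmplitudeFloor_of_two_le hq).exists_amplitude_le_of_heat_le hd hw hdw hheat hδ

end Summit.NavierStokesRegularity.FunctionalMining

end
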